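import Summits.ABC.IUTFork.Joshi.FundamentalEstimateBL
import Summits.ABC.IUTFork.Joshi.TestHarness
import Summits.ABC.IUTFork.Cor312StatementBridgeChecks
import Mathlib.Analysis.SpecialFunctions.Log.Basic
import HarnessLib

/-!
# TEST X-05 (O-024): Joshi's Thm. 7.3.1 for `Θ̃^{B_{L′}}` vs the typed [IUTchIII] Cor. 3.12 — the SUMMED volume shape

Block E of the abc-iut cell (rung LADDER-ABC:A2.E), seat abc-iut-E-t12; test row X-05 of plan/E/OBJECTS.tsv for the object
O-024 = `ATS3.AdelicThetaDatum.FundamentalEstimateBL` ([J-III] = K. Joshi, arXiv:2401.13508v4, Thm. 7.3.1; typed, never asserted,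
in `Joshi/FundamentalEstimateBL.lean`, p428437), under E-PLAN rulings R2 (volume inequalities are tested against
`Cor312.Setting.Statement` through the volume route, never against `S = Cor312Vol.PilotKummerIndRelated`), R9 (report grammar
«S-BYPASSED shape=… + STATEMENT-DIRECT … via Y=…»; COUNTERMODEL is unavailable by theorem for volume shapes), R13/R14 (residuals
named by decl; OUR frozen decls bound only in `Joshi/Dictionary*.lean` / `Joshi/Test*.lean` — this is a Test file). PROOF-ONLY over
frozen files and E-cx's harness `Joshi/TestHarness.lean` (p428758); nothing of [IUTchIII] and nothing of Joshi is asserted; the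
dictionary sentences are `Prop`-valued candidate hypotheses labelled OUR READING.

WHAT THE KERNEL RECORDS.
1. THE SHAPE OF THM. 7.3.1 IS «SD» (summed domination), a new rung BELOW the harness's packetwise shapes: Joshi's right-hand
   side `∏_{w∈𝕍^{odd,ss}} |q_w^{1/2ℓ}|^{ℓ*} = exp Σ_w Σ_{j=1}^{ℓ*} (1/2ℓ)·log|q_w|` is the LABEL-AND-PLACE-SUMMED q-quantity and his local step
   (`LocalThetaEstimateAt`, p.56 l.38–61) is a `j`-PRODUCT at each `w`, not a packetwise statement; so Thm. 7.3.1 matches the line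
   `Σ_i Σᶠ_{v_ℚ} qLocal ≤ Σ_i Σᶠ_{v_ℚ} thetaLocal` of the volume route (`SummedDomination`, §1). Lattice, all in kernel here or in the
   harness: VT ⟹ SVB ⟺ HVD ⟹ SD (`summedDomination_of_hullVolumeDominance`) and **SD ⟺ Statement** given `ThetaFinite`
   (`statement_of_summedDomination`, `summedDomination_of_statement`): the summed shape is EXACTLY Statement-strength — under any
   additive dictionary Joshi's §7 inequality RESTATES the inequality clause of Cor. 3.12 (restatement probe R3 outcome for O-024:
   «equivalent»), it is not a route to it; and, like every volume shape, it is separated from `S` by any Statement ∧ ¬S model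
   (E-cx's `expSetting p (2,4)`, Joshi/TestHarnessSeparation).
2. THE DICTIONARY `VolumeDictionaryBL` (§2) = `QVolumeReading ∧ ThetaVolumeReading`, binding Joshi's `B_{L′}`-sizes to OUR summed
   procession volumes — BOTH labelled OUR READING / NOT-IN-PRINT for §7: Joshi scopes §7 as the `B_{L′}`-valued version and defers
   the log-shell (tensor-packet) version to his §9 (p.53 l.36–38, quoted in `FundamentalEstimateBL.lean`).
3. STATEMENT-DIRECT: `statement_of_fundamentalEstimateBL` — Thm. 7.3.1 AS TYPED (hypothesis) + `VolumeDictionaryBL` + the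
   Corollary's own finiteness clause `ThetaFinite` ⟹ `P.Statement` (transitivity and `log`); also from the printed MECHANISM, the
   local step at one `ρ` (`statement_of_localThetaEstimateAt`).
4. J-DATUM-LEVEL PINNED DATA (R13: «J-FALSE-AT-PINNED»-type data, not COUNTERMODEL): at `Cor312Vol.PinnedWitness.pinnedSetting p`
   (p419720: typed Thm. 3.11, `BridgeHyps`, `PinnedRegions3` hold, Statement FAILS) the dictionary fails for EVERY Joshi datum
   satisfying his inequality (`not_volumeDictionaryBL_pinnedSetting`), and such data exist with Thm. 7.3.1 PROVED through its local
   step (`toyDatum_fundamentalEstimateBL`: one place, `|Ξ_j| = 2`, `|q| = 1/2`) — Joshi's §7 inequality holds in his ring while the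
   volume dictionary to the countermodel's packets fails: the dictionary carries the load.
5. CONSISTENCY (degenerate dict model): on c312-6's nonempty toy `Cor312Vol.Checks.toySettingNE` (all log-volumes `0`, Statement
   true) the dictionary holds for the trivial datum (`𝕍^{odd,ss} = ∅`): `volumeDictionaryBL_trivialDatum_toySettingNE` — J ∧ Y ∧
   ThetaFinite ∧ Statement jointly satisfiable in kernel, degenerately (non-degenerate models are E-cx's X-04).

REPORT LINE (R9): «E TEST J3:Thm7.3.1 (O-024): S-BYPASSED shape=SD (summed domination ⟸ HVD; SD ⟺ Statement under ThetaFinite)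
sep-model = Joshi/TestHarnessSeparation expSetting p (2,4) + STATEMENT-DIRECT p<this> [inputs ThetaFinite] via Y=VolumeDictionaryBL
(= QVolumeReading ∧ ThetaVolumeReading, OUR READING, NOT-IN-PRINT for §7; dict model: degenerate p<this> | non-degenerate none yet)
+ J-datum pinned data: Y false at pinnedSetting for every J-true datum + faithfulness <E-ref>». FRAMING (binding): locates /
conditionally verifies; NO abc claim; no side taken on [IUTchIII] Cor. 3.12, on Joshi's claims or on Mochizuki's 2024 report;
typed ≠ proved; typed AS A CANDIDATE ≠ endorsed; never «Joshi proves Cor. 3.12».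
-/

noncomputable section

open Set Finset

namespace Summit.ABC.IUTFork.Joshi.ATS3

open Thm311 Cor312 Cor312Vol Literature.IUT.LogThetaLattice Summit.ABC.IUTFork.Joshi

/-! ## 1. OUR side: the summed form of the volume route -/

section OurSide

variable {T : ThetaIndex} {S : Situation T} (P : Cor312.Setting S)

/-- The label-and-place SUMMED `q`-side of Cor. 3.12: `Σ_{i} Σᶠ_{v_ℚ} qLocal (i+1) v_ℚ` (`= ℓ* · (−|log(q)|)`).
[claim: Mochizuki2012, status: disputed] -/
def qSum : ℝ := ∑ i : Fin T.lstar, ∑ᶠ vQ : T.VQ, P.qLocal (Setting.labelSucc i) vQ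

/-- The label-and-place SUMMED Θ-side: `Σ_{i} Σᶠ_{v_ℚ} thetaLocal (i+1) v_ℚ` read as real numbers (`= ℓ* · (−|log(Θ)|)` under
`ThetaFinite`). [claim: Mochizuki2012, status: disputed] -/
def thetaSum : ℝ := ∑ i : Fin T.lstar, ∑ᶠ vQ : T.VQ, (P.thetaLocal (Setting.labelSucc i) vQ).untopD 0

/-- `−|log(q)| = qSum / ℓ*` (procession normalisation is the plain average, [IUTchIII] Prop. 3.9 (i)). [folklore] -/
theorem negLogQ_eq_qSum_div : P.negLogQ = qSum P / T.lstar := rfl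

/-- **SD — summed domination**: the label-and-place-summed `q`-side is at most the summed hull side (the shape of [J-III] Thm. 7.3.1
under an additive dictionary; one rung below the harness's packetwise `HullVolumeDominance`). TEST SHAPE, never asserted.
[claim: Joshi2024ATS3, status: disputed] -/
@[claim "Joshi2024ATS3" "disputed"]
def SummedDomination : Prop := qSum P ≤ thetaSum P

/-- **SD ⟹ Statement** (OUR side; weaker hypothesis than `Cor312Vol.VolumeTransport` / `HullVolumeDominance`, same last two lines as
`Cor312Vol.statement_of_volumeTransport`): if `−|log(Θ)|` is finite and the summed `q`-side is at most the summed hull side, the typed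
Cor. 3.12 Statement holds. Kernel glue; nothing asserted. [folklore] -/
theorem statement_of_summedDomination (hfin : P.ThetaFinite) (h : SummedDomination P) : P.Statement := by
  constructor
  · unfold Setting.negLogTheta
    rw [if_pos hfin]
    exact WithTop.coe_ne_top
  · unfold Setting.negLogTheta
    rw [if_pos hfin, WithTop.coe_le_coe]
    unfold Setting.negLogQ processionNormalized
    exact div_le_div_of_nonneg_right h (Nat.cast_nonneg _)

/-- **Statement ⟹ SD**: so, given `ThetaFinite`, SD is EQUIVALENT to the Statement — the summed shape is exactly
Statement-strength (restatement probe R3 for O-024: «equivalent»), and every Statement ∧ ¬S model separates SD from S. [folklore] -/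
theorem summedDomination_of_statement (h : P.Statement) : SummedDomination P := by
  have hl : 0 < T.lstar := lt_of_lt_of_le (by norm_num) T.two_le_lstar
  obtain ⟨hne, hle⟩ := h
  have hfin : P.ThetaFinite := by
    by_contra hc
    apply hne
    unfold Setting.negLogTheta
    rw [if_neg hc]
  unfold Setting.negLogTheta at hle
  rw [if_pos hfin, WithTop.coe_le_coe] at hle
  unfold Setting.negLogQ processionNormalized at hle
  have hl' : (0 : ℝ) < T.lstar := by exact_mod_cast hl
  unfold SummedDomination qSum thetaSum
  exact (div_le_div_iff_of_pos_right hl').1 hle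

/-- SD ⟺ Statement under `ThetaFinite`. [folklore] -/
theorem summedDomination_iff_statement (hfin : P.ThetaFinite) : SummedDomination P ↔ P.Statement :=
  ⟨statement_of_summedDomination P hfin, summedDomination_of_statement P⟩

/-- **HVD ⟹ SD** under the bridge hypotheses (packetwise ⟹ summed; with the harness: VT ⟹ SVB ⟺ HVD ⟹ SD). [folklore] -/
theorem summedDomination_of_hullVolumeDominance (H : BridgeHyps P) (h : HullVolumeDominance P) : SummedDomination P :=
  summedDomination_of_statement P (statement_of_hullVolumeDominance H h)

/-- **VT ⟹ SD** (through the harness lattice). [folklore] -/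
theorem summedDomination_of_volumeTransport (H : BridgeHyps P) (hadm : ThetaRegionsAdm P) (h : VolumeTransport P) :
    SummedDomination P :=
  summedDomination_of_statement P (statement_of_volumeTransport P H hadm h)

end OurSide

/-! ## 2. The volume dictionary `Y_vol^{BL}` (OUR READING; NOT-IN-PRINT for §7) -/

section Dictionary

variable (D : AdelicThetaDatum) {T : ThetaIndex} {S : Situation T} (P : Cor312.Setting S)

/-- **`QVolumeReading` (OUR READING, NOT-IN-PRINT for [J-III] §7):** the summed `q`-side of OUR Cor. 3.12 setting is at most
the logarithm of Joshi's q-bound `∏_{w∈𝕍^{odd,ss}} |q_w|^{ℓ*/(2ℓ)}` — the reading under which "`∏_w |q_w^{1/2ℓ}|^{ℓ*}`" (Thm. 7.3.1,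
p.55 l.21–30) IS the label-and-place-summed q-pilot log-volume (`ℓ*` labels × `(1/2ℓ)·log|q_w|` per bad place). Candidate
dictionary hypothesis; never asserted. [claim: Joshi2024ATS3, status: disputed] -/
def QVolumeReading : Prop := qSum P ≤ Real.log D.qBound

/-- **`ThetaVolumeReading` (OUR READING, NOT-IN-PRINT for [J-III] §7 — Joshi defers the packet version to §9, p.53
l.36–38):** Joshi's size `|Θ̃^{B_{L′}}_Joshi|_{B_{L′}}` of the locus is at most `exp` of OUR summed hull log-volume `thetaSum` (the
holomorphic hull of the union of the possible images is "at least as large as" Joshi's `B_{L′}`-locus). Candidate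
dictionary hypothesis; never asserted. [claim: Joshi2024ATS3, status: disputed] -/
def ThetaVolumeReading : Prop := D.size D.locus ≤ ((Real.exp (thetaSum P) : ℝ) : EReal)

/-- **`VolumeDictionaryBL`** — the volume dictionary for the `B_{L′}`-locus = the conjunction of the two readings (R13: residuals are
named by decl; the one-prime analogue is E-t3's `Joshi.VolumeDictionary`). OUR READING; never asserted.
[claim: Joshi2024ATS3, status: disputed] -/
def VolumeDictionaryBL : Prop := QVolumeReading D P ∧ ThetaVolumeReading D P

/-- Joshi's Thm. 7.3.1 AS TYPED + the two readings ⟹ SD (transitivity and `log`). [folklore] -/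
theorem summedDomination_of_fundamentalEstimateBL (hJ : D.FundamentalEstimateBL) (hq : QVolumeReading D P)
    (hΘ : ThetaVolumeReading D P) : SummedDomination P := by
  refine hq.trans ?_
  have h1 : ((D.qBound : ℝ) : EReal) ≤ ((Real.exp (thetaSum P) : ℝ) : EReal) := hJ.trans hΘ
  have h2 : D.qBound ≤ Real.exp (thetaSum P) := EReal.coe_le_coe_iff.1 h1
  exact (Real.log_le_log D.qBound_pos h2).trans (Real.log_exp _).le

/-- **X-05 (O-024), STATEMENT-DIRECT:** Joshi's Thm. 7.3.1 AS TYPED (`FundamentalEstimateBL`, a hypothesis), the volume dictionary,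
and the Corollary's finiteness clause give the typed Cor. 3.12 Statement. Kernel glue (transitivity, `log`/`exp`); no clause of
Cor. 3.12 and no claim of Joshi is asserted. [folklore] -/
theorem statement_of_fundamentalEstimateBL (hJ : D.FundamentalEstimateBL) (hq : QVolumeReading D P)
    (hΘ : ThetaVolumeReading D P) (hfin : P.ThetaFinite) : P.Statement :=
  statement_of_summedDomination P hfin (summedDomination_of_fundamentalEstimateBL D P hJ hq hΘ)

/-- The dictionary form. [folklore] -/
theorem statement_of_volumeDictionaryBL (hJ : D.FundamentalEstimateBL) (hY : VolumeDictionaryBL D P) (hfin : P.ThetaFinite) :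
    P.Statement :=
  statement_of_fundamentalEstimateBL D P hJ hY.1 hY.2 hfin

/-- The same from Joshi's LOCAL STEP at one `ρ` (the printed mechanism: one exhibited element dominates) instead of the
theorem's conclusion. [folklore] -/
theorem statement_of_localThetaEstimateAt {ρ : ℝ} (hρ : ρ ∈ Set.Ioc (0 : ℝ) 1) (hJ : D.LocalThetaEstimateAt ρ)
    (hq : QVolumeReading D P) (hΘ : ThetaVolumeReading D P) (hfin : P.ThetaFinite) : P.Statement :=
  statement_of_fundamentalEstimateBL D P (D.fundamentalEstimateBL_of_localThetaEstimateAt hρ hJ) hq hΘ hfin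

end Dictionary

/-! ## 3. J-datum-level pinned data: the dictionary fails at the pinned countermodel for every Joshi datum -/

section Countermodel

open Cor312Vol.PinnedWitness

variable (p : ℕ) [hp : Fact p.Prime]

/-- **At the pinned countermodel the volume dictionary FAILS for every datum satisfying Joshi's inequality**: there
(`Cor312Vol.PinnedWitness.pinnedSetting p`, p419720) typed Thm. 3.11, `BridgeHyps` (so `ThetaFinite`) and `PinnedRegions3`
hold while the Statement fails (`pinnedSetting_not_statement`), so by §2 the conjunction of the two readings is refuted.
The content of "Joshi's §7 ⟹ Cor. 3.12" therefore sits in the dictionary, not in Thm. 7.3.1. [folklore] -/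
theorem not_volumeDictionaryBL_pinnedSetting (D : AdelicThetaDatum) (hJ : D.FundamentalEstimateBL) :
    ¬ VolumeDictionaryBL D (pinnedSetting p) := fun h =>
  pinnedSetting_not_statement p (statement_of_volumeDictionaryBL D (pinnedSetting p) hJ h (pinnedSetting_bridgeHyps p).finite)

/-- SD itself fails at the pinned countermodel (as every volume shape does there, R9). [folklore] -/
theorem pinnedSetting_not_summedDomination : ¬ SummedDomination (pinnedSetting p) := fun h =>
  pinnedSetting_not_statement p (statement_of_summedDomination _ (pinnedSetting_bridgeHyps p).finite h)

end Countermodel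

/-! ## 4. Non-vacuity: a Joshi datum where Thm. 7.3.1 is PROVED (through its local step) -/

section ToyDatum

/-- A one-place toy datum: `𝕍_{L′} = 𝕍^{odd,ss} = {∗}`, `ℓ* = 2` (`ℓ = 5`), `B = ℝ` with `|·|_ρ = |·|` for every `ρ`, the locus a
single element `Ξ = (2, 2)`, `|q| = 1/2`. Interface-level witness only (NOT a model of Joshi's rings). [folklore] -/
def toyDatum : AdelicThetaDatum where
  W := Unit
  Vss := Finset.univ
  lstar := 2
  two_le_lstar := le_rfl
  prime_ell := Nat.prime_five
  B := fun _ => ℝ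
  one := fun _ => 1
  nrm := fun _ _ x => |x|
  nrm_nonneg := fun _ _ x => abs_nonneg x
  nrm_one := fun _ _ => abs_one
  top := fun _ => inferInstance
  continuous_nrm := fun _ _ _ => continuous_abs
  Bplus := fun _ => {x | |x| ≤ 1}
  nrm_le_one_of_mem_Bplus := fun _ _ hx => hx
  Idx := Unit
  Xi := fun _ _ _ => 2
  Xi_off := fun _ w hw => absurd (Finset.mem_univ w) hw
  std := ()
  qAbs := fun _ => 1 / 2
  qAbs_pos := fun _ _ => by norm_num
  qAbs_lt_one := fun _ _ => by norm_num

/-- The local step of Thm. 7.3.1 HOLDS for the toy datum at `ρ = 1`: `(1/2)^{2/10} < 1 < |2|·|2|`. [folklore] -/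
theorem toyDatum_localThetaEstimateAt : toyDatum.LocalThetaEstimateAt 1 := by
  intro w _
  have hlt : (toyDatum.qAbs w) ^ ((toyDatum.lstar : ℝ) / (2 * toyDatum.ell)) < 1 :=
    Real.rpow_lt_one (by show (0 : ℝ) ≤ 1 / 2; norm_num) (by show (1 / 2 : ℝ) < 1; norm_num)
      (by show (0 : ℝ) < ((2 : ℕ) : ℝ) / (2 * ((2 * 2 + 1 : ℕ) : ℝ)); norm_num)
  refine hlt.trans_le ?_
  show (1 : ℝ) ≤ ∏ _j : Fin 2, |(2 : ℝ)|
  rw [Fin.prod_univ_two]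
  norm_num

/-- **Joshi's Thm. 7.3.1 is PROVED for the toy datum** (via `fundamentalEstimateBL_of_localThetaEstimateAt`): the
hypothesis `FundamentalEstimateBL` of §2–§3 is satisfiable, so `not_volumeReadings_pinnedSetting` is not vacuous. [folklore] -/
theorem toyDatum_fundamentalEstimateBL : toyDatum.FundamentalEstimateBL :=
  toyDatum.fundamentalEstimateBL_of_localThetaEstimateAt ⟨one_pos, le_rfl⟩ toyDatum_localThetaEstimateAt

/-- Hence, concretely: the volume dictionary between the toy Joshi datum and the pinned countermodel fails. [folklore] -/
theorem not_volumeDictionaryBL_toyDatum_pinnedSetting (p : ℕ) [Fact p.Prime] :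
    ¬ VolumeDictionaryBL toyDatum (Cor312Vol.PinnedWitness.pinnedSetting p) :=
  not_volumeDictionaryBL_pinnedSetting p toyDatum toyDatum_fundamentalEstimateBL

end ToyDatum

/-! ## 5. Consistency (degenerate): J ∧ Y ∧ ThetaFinite ∧ Statement on the nonempty toy setting -/

section Consistency

open Cor312.Checks

/-- The trivial datum: one place, NO bad place (`𝕍^{odd,ss} = ∅`), locus `{([1],[1])}`; so `qBound = 1` (empty product) and
every size is `1`. Degenerate on purpose (see `volumeReadings_trivialDatum_toySettingNE`). [folklore] -/
def trivialDatum : AdelicThetaDatum where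
  W := Unit
  Vss := ∅
  lstar := 2
  two_le_lstar := le_rfl
  prime_ell := Nat.prime_five
  B := fun _ => ℝ
  one := fun _ => 1
  nrm := fun _ _ x => |x|
  nrm_nonneg := fun _ _ x => abs_nonneg x
  nrm_one := fun _ _ => abs_one
  top := fun _ => inferInstance
  continuous_nrm := fun _ _ _ => continuous_abs
  Bplus := fun _ => {x | |x| ≤ 1}
  nrm_le_one_of_mem_Bplus := fun _ _ hx => hx
  Idx := Unit
  Xi := fun _ _ _ => 1
  Xi_off := fun _ _ _ => rfl
  std := ()
  qAbs := fun _ => 1 / 2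
  qAbs_pos := fun _ _ => by norm_num
  qAbs_lt_one := fun _ _ => by norm_num

/-- `qBound (trivialDatum) = 1` (empty product). [folklore] -/
theorem trivialDatum_qBound : trivialDatum.qBound = 1 := by
  unfold AdelicThetaDatum.qBound; rfl

/-- Every member of the trivial locus has size `1`. [folklore] -/
theorem trivialDatum_adelicSize (ρ : ℝ) (z : trivialDatum.Idx) : trivialDatum.adelicSize ρ (trivialDatum.Xi z) = 1 := by
  rw [trivialDatum.adelicSize_Xi_eq_prod]; rfl

/-- The trivial locus has size `≤ 1`. [folklore] -/
theorem trivialDatum_size_le_one : trivialDatum.size trivialDatum.locus ≤ 1 := by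
  refine iSup₂_le fun ρ _ => trivialDatum.sizeAt_le_coe (C := 1) ?_
  rintro x ⟨z, rfl⟩
  rw [trivialDatum_adelicSize]

/-- Joshi's inequality holds (trivially) for the trivial datum. [folklore] -/
theorem trivialDatum_fundamentalEstimateBL : trivialDatum.FundamentalEstimateBL := by
  unfold AdelicThetaDatum.FundamentalEstimateBL
  rw [trivialDatum_qBound]
  have h := trivialDatum.adelicSize_le_size (trivialDatum.Xi_mem_locus ()) (ρ := 1) ⟨one_pos, le_rfl⟩
  rwa [trivialDatum_adelicSize] at h

/-- On c312-6's nonempty toy setting every `q`-local term is `0`. [folklore] -/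
theorem toySettingNE_qLocal (j : toyIndex.Label) (vQ : toyIndex.VQ) : Cor312Vol.Checks.toySettingNE.qLocal j vQ = 0 := by
  classical
  unfold Setting.qLocal
  show (if _ then (0 : ℝ) else 0) = 0
  exact ite_self _

/-- `qSum (toySettingNE) = 0`. [folklore] -/
theorem toySettingNE_qSum : qSum Cor312Vol.Checks.toySettingNE = 0 := by
  unfold qSum; simp [toySettingNE_qLocal]

/-- `thetaSum (toySettingNE) = 0`. [folklore] -/
theorem toySettingNE_thetaSum : thetaSum Cor312Vol.Checks.toySettingNE = 0 := by
  unfold thetaSum; simp [Cor312Vol.Checks.toySettingNE_thetaLocal]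

/-- **Degenerate joint consistency**: the trivial Joshi datum and c312-6's nonempty toy setting satisfy J (Thm. 7.3.1 as
typed), both readings, `ThetaFinite`, and the Statement — all in kernel. Degenerate (no bad place, all volumes `0`);
recorded only so that the FILLS-MODULO-Y line is not vacuous by construction; non-degenerate models are E-cx's X-04. [folklore] -/
theorem volumeDictionaryBL_trivialDatum_toySettingNE :
    trivialDatum.FundamentalEstimateBL ∧ VolumeDictionaryBL trivialDatum Cor312Vol.Checks.toySettingNE ∧
      Cor312Vol.Checks.toySettingNE.ThetaFinite ∧ Cor312Vol.Checks.toySettingNE.Statement := by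
  have hq : QVolumeReading trivialDatum Cor312Vol.Checks.toySettingNE := by
    unfold QVolumeReading; rw [toySettingNE_qSum, trivialDatum_qBound, Real.log_one]
  have hΘ : ThetaVolumeReading trivialDatum Cor312Vol.Checks.toySettingNE := by
    unfold ThetaVolumeReading; rw [toySettingNE_thetaSum, Real.exp_zero]
    exact trivialDatum_size_le_one
  exact ⟨trivialDatum_fundamentalEstimateBL, ⟨hq, hΘ⟩, Cor312Vol.Checks.toySettingNE_thetaFinite,
    statement_of_fundamentalEstimateBL _ _ trivialDatum_fundamentalEstimateBL hq hΘ
      Cor312Vol.Checks.toySettingNE_thetaFinite⟩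

end Consistency

end Summit.ABC.IUTFork.Joshi.ATS3

end
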